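import Literature.AlgebraicGeometry.Frobenioids.DivisorMonoidIsoDescent
import HarnessLib

/-!
# Frobenioids I, Corollary 4.11 (ii) — `1`-uniqueness of `Ψ^Base` and the reduction of (ii) to the
# existence of a `1`-commuting equivalence of base categories

Mochizuki, *The geometry of Frobenioids I: the general theory*, Kyushu J. Math. **62** (2008)
293–400, kurims text proof of Cor. 4.11 (ii) p. 94: "Thus, by composing diagrams, we obtain a
1-commutative diagram as in the statement of assertion (ii), which is easily verified to be 1-unique.
Finally, the rigidity assertion … follows from Proposition 1.13, (i)" [cite: MochizukiFrdI2008, Cor. 4.11 (ii) p.94].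

PROOF-ONLY companion of `DivisorMonoidCategoryTheoreticity.lean` (seat abc-iut-L1-t3), generic over the
operations `S_i : PreFrobenioidData C_i D_i`; the same "`D^* ⥲ D`" technique as
`DivisorMonoidIsoDescent.lean`, now for natural isomorphisms of functors out of `D₁`:

* `nonempty_iso_of_iso_whisker_base`: under Def. 1.3 (i)(a)(b)(c) of `C₁ → D₁` (operations form),
  whiskering with `Base₁ : C₁ → D₁` reflects isomorphy of functors — `Base₁ ⋙ G ≅ Base₁ ⋙ G'` implies
  `G ≅ G'` ("easily verified to be 1-unique");
* `oneUniqueSquare_base_of_oneCommutes`: hence ANY equivalence `Ψ^Base : D₁ ⥤ D₂` that `1`-commutes with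
  `Ψ` over the `Base_i` is `1`-unique, i.e. satisfies the typed `OneUniqueSquare`;
* `isRigidFunctor_congr`: rigidity is invariant under isomorphism of functors;
* `cor411ii_of_exists_base_equivalence`: the typed Cor. 4.11 (ii) REDUCED to (E) the existence of an
  equivalence `Ψ^Base` with `Base₂ ∘ Ψ ≅ Ψ^Base ∘ Base₁` and (R) the rigidity of `Base₂ ∘ Ψ` for slim
  `D₁, D₂` (Prop. 1.13 (i): `C₂ → D₂` is rigid for slim `D₂`, and precomposition with the equivalence `Ψ`).

No statement of the paper is strengthened; nothing here is specific to the abc programme.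
-/

namespace Literature.AlgebraicGeometry.Frobenioids

open CategoryTheory Opposite

universe w w₁ w₂ v v' v₁ v₁' v₂ v₂' v₃ u u' u₁ u₁' u₂ u₂' u₃

namespace PreFrobenioidData

section Rigid

variable {P : Type u₁} [Category.{v₁} P] {Q : Type u₂} [Category.{v₂} Q]

/-- Rigidity of a functor is invariant under isomorphism of functors (conjugate an automorphism of `G'`
by the isomorphism). [cite: MochizukiFrdI2008, §0 p.14] -/
theorem isRigidFunctor_congr {G G' : P ⥤ Q} (i : G ≅ G') (hG : IsRigidFunctor G) : IsRigidFunctor G' := by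
  intro α
  have h := hG (i ≪≫ α ≪≫ i.symm)
  have h' : α = i.symm ≪≫ (i ≪≫ α ≪≫ i.symm) ≪≫ i := by
    ext X
    simp
  rw [h', h]
  ext X
  simp

end Rigid

section OneFrobenioid

variable {C₁ : Type u₁} [Category.{v₁} C₁] {D₁ : Type u₁'} [Category.{v₁'} D₁]
variable {S₁ : PreFrobenioidData.{w₁} C₁ D₁}
variable {E : Type u₃} [Category.{v₃} E]

/-- INDEPENDENCE for natural transformations out of `Base₁`: if every base-isomorphism
`g : Base A₀ ≅ Base A` is `Base(ψ) ∘ Base(φ)⁻¹` for arrows `φ : X → A₀`, `ψ : X → A` with `Base(φ)`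
invertible (Def. 1.3 (i)(b)), then the components of `τ : Base₁ ⋙ G ≅ Base₁ ⋙ G'` at `A₀` and `A` are
intertwined by `G g`, `G' g`. [cite: MochizukiFrdI2008, Cor. 4.11 (ii) p.94] -/
theorem whisker_base_app_natural
    (hconn : ∀ (A B : C₁) (g : S₁.base.obj A ≅ S₁.base.obj B), ∃ (X : C₁) (φ : X ⟶ A) (ψ : X ⟶ B),
      IsIso (S₁.base.map φ) ∧ S₁.base.map φ ≫ g.hom = S₁.base.map ψ)
    {G G' : D₁ ⥤ E} (t : ∀ A : C₁, G.obj (S₁.base.obj A) ≅ G'.obj (S₁.base.obj A))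
    (ht : ∀ ⦃X A : C₁⦄ (φ : X ⟶ A), G.map (S₁.base.map φ) ≫ (t A).hom = (t X).hom ≫ G'.map (S₁.base.map φ))
    {A₀ A : C₁} (g : S₁.base.obj A₀ ≅ S₁.base.obj A) :
    G.map g.hom ≫ (t A).hom = (t A₀).hom ≫ G'.map g.hom := by
  obtain ⟨X, φ, ψ, hφ, hg⟩ := hconn A₀ A g
  have hg' : g.hom = inv (S₁.base.map φ) ≫ S₁.base.map ψ := by
    rw [← hg, IsIso.inv_hom_id_assoc]
  have h1 : G.map (inv (S₁.base.map φ)) ≫ (t X).hom = (t A₀).hom ≫ G'.map (inv (S₁.base.map φ)) := by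
    rw [← cancel_epi (G.map (S₁.base.map φ)), ← G.map_comp_assoc, IsIso.hom_inv_id, G.map_id,
      Category.id_comp, ← Category.assoc, ht φ, Category.assoc, ← G'.map_comp, IsIso.hom_inv_id, G'.map_id,
      Category.comp_id]
  rw [hg', G.map_comp, G'.map_comp, Category.assoc, ht ψ, ← Category.assoc, h1, Category.assoc]

/-- "Easily verified to be `1`-unique" (FrdI proof of Cor. 4.11 (ii) p. 94): under Def. 1.3 (i)(a)(b)(c)
of `C₁ → D₁` in operations form, whiskering with `Base₁` reflects isomorphy of functors out of `D₁` — an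
isomorphism `Base₁ ⋙ G ≅ Base₁ ⋙ G'` descends to `G ≅ G'` (components at `X ≅ Base A` by transport,
naturality along `f : Y → X` through a lift of `f` to an arrow of `C₁` up to isomorphism).
[cite: MochizukiFrdI2008, Cor. 4.11 (ii) p.94] -/
theorem nonempty_iso_of_iso_whisker_base
    (hbase : ∀ X : D₁, ∃ A : C₁, Nonempty (S₁.base.obj A ≅ X))
    (hconn : ∀ (A B : C₁) (g : S₁.base.obj A ≅ S₁.base.obj B), ∃ (X : C₁) (φ : X ⟶ A) (ψ : X ⟶ B),
      IsIso (S₁.base.map φ) ∧ S₁.base.map φ ≫ g.hom = S₁.base.map ψ)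
    (hpb : ∀ (A : C₁) {Y : D₁} (f : Y ⟶ S₁.base.obj A),
      ∃ (A' : C₁) (φ : A' ⟶ A) (e : S₁.base.obj A' ≅ Y), S₁.base.map φ = e.hom ≫ f)
    {G G' : D₁ ⥤ E} (τ : S₁.base ⋙ G ≅ S₁.base ⋙ G') : Nonempty (G ≅ G') := by
  classical
  -- pointwise form of `τ`
  let t : ∀ A : C₁, G.obj (S₁.base.obj A) ≅ G'.obj (S₁.base.obj A) := fun A => τ.app A
  have ht : ∀ ⦃X A : C₁⦄ (φ : X ⟶ A),
      G.map (S₁.base.map φ) ≫ (t A).hom = (t X).hom ≫ G'.map (S₁.base.map φ) :=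
    fun X A φ => τ.hom.naturality φ
  have hind := fun {A₀ A : C₁} (g : S₁.base.obj A₀ ≅ S₁.base.obj A) =>
    whisker_base_app_natural hconn t ht g
  -- choices (a)
  choose A hA using hbase
  have e : ∀ X : D₁, S₁.base.obj (A X) ≅ X := fun X => (hA X).some
  -- components `c X : G X ≅ G' X`
  let c : ∀ X : D₁, G.obj X ≅ G'.obj X := fun X => G.mapIso (e X).symm ≪≫ t (A X) ≪≫ G'.mapIso (e X)
  refine ⟨NatIso.ofComponents c fun {Y X} f => ?_⟩
  show G.map f ≫ G.map (e X).inv ≫ (t (A X)).hom ≫ G'.map (e X).hom =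
    (G.map (e Y).inv ≫ (t (A Y)).hom ≫ G'.map (e Y).hom) ≫ G'.map f
  -- (c): lift `f ≫ (e X)⁻¹` to `φ : A' → A X` up to `e' : Base A' ≅ Y`
  obtain ⟨A', φ, e', hφ⟩ := hpb (A X) (f ≫ (e X).inv)
  have h1 := ht φ
  rw [hφ] at h1
  -- independence between `A'` and the chosen `A Y`
  have h2 := hind (e' ≪≫ (e Y).symm)
  simp only [Iso.trans_hom, Iso.symm_hom, Functor.map_comp, Category.assoc] at h1 h2
  -- `G f ≫ G (e X)⁻¹ = G e'⁻¹ ≫ G (e' ≫ f ≫ (e X)⁻¹)`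
  have h3 : G.map f ≫ G.map (e X).inv ≫ (t (A X)).hom ≫ G'.map (e X).hom =
      G.map e'.inv ≫ (G.map e'.hom ≫ G.map f ≫ G.map (e X).inv ≫ (t (A X)).hom) ≫ G'.map (e X).hom := by
    simp only [Category.assoc, ← G.map_comp_assoc, e'.inv_hom_id_assoc]
  rw [h3, h1]
  -- `(t (A Y)).hom = G (e Y ≫ e'⁻¹) ≫ (t A').hom ≫ G' (e' ≫ (e Y)⁻¹)`
  have h4 : (t (A Y)).hom = G.map (e Y).hom ≫ G.map e'.inv ≫ (t A').hom ≫ G'.map e'.hom ≫ G'.map (e Y).inv := by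
    rw [← h2]
    simp only [← G.map_comp_assoc, Iso.inv_hom_id_assoc, Iso.hom_inv_id, CategoryTheory.Functor.map_id,
      Category.id_comp]
  rw [h4]
  simp only [Category.assoc, ← G'.map_comp, ← G.map_comp_assoc, Iso.inv_hom_id_assoc, Iso.inv_hom_id,
    Category.comp_id]

end OneFrobenioid

section TwoFrobenioids

variable {C₁ : Type u₁} [Category.{v₁} C₁] {D₁ : Type u₁'} [Category.{v₁'} D₁]
variable {C₂ : Type u₂} [Category.{v₂} C₂] {D₂ : Type u₂'} [Category.{v₂'} D₂]
variable (S₁ : PreFrobenioidData.{w₁} C₁ D₁) (S₂ : PreFrobenioidData.{w₂} C₂ D₂) (Ψ : C₁ ≌ C₂)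

/-- Under Def. 1.3 (i)(a)(b)(c) of `C₁ → D₁` (operations form), ANY equivalence `Ψ^Base : D₁ ⥤ D₂` that
`1`-commutes with `Ψ` over `Base₁`, `Base₂` is `1`-unique — the typed `OneUniqueSquare` of Cor. 4.11 (ii) /
Thm. 3.4 (v) ("easily verified to be 1-unique", FrdI p. 94). [cite: MochizukiFrdI2008, Cor. 4.11 (ii) p.94] -/
theorem oneUniqueSquare_base_of_oneCommutes
    (hbase : ∀ X : D₁, ∃ A : C₁, Nonempty (S₁.base.obj A ≅ X))
    (hconn : ∀ (A B : C₁) (g : S₁.base.obj A ≅ S₁.base.obj B), ∃ (X : C₁) (φ : X ⟶ A) (ψ : X ⟶ B),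
      IsIso (S₁.base.map φ) ∧ S₁.base.map φ ≫ g.hom = S₁.base.map ψ)
    (hpb : ∀ (A : C₁) {Y : D₁} (f : Y ⟶ S₁.base.obj A),
      ∃ (A' : C₁) (φ : A' ⟶ A) (e : S₁.base.obj A' ≅ Y), S₁.base.map φ = e.hom ≫ f)
    (ΨBase : D₁ ⥤ D₂) [ΨBase.IsEquivalence] (hsq : OneCommutes Ψ.functor S₂.base S₁.base ΨBase) :
    OneUniqueSquare Ψ.functor S₁.base S₂.base ΨBase := by
  refine ⟨inferInstance, hsq, fun B' hB' => ?_⟩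
  obtain ⟨η⟩ := hsq
  obtain ⟨η'⟩ := hB'
  exact nonempty_iso_of_iso_whisker_base hbase hconn hpb (η'.symm ≪≫ η)

/-- **Corollary 4.11 (ii) REDUCED** (FrdI p. 94: "by composing diagrams, we obtain a 1-commutative
diagram as in the statement of assertion (ii), which is easily verified to be 1-unique. Finally, the
rigidity assertion … follows from Proposition 1.13, (i)"): under Def. 1.3 (i)(a)(b)(c) of `C₁ → D₁`
(operations form), the typed Cor. 4.11 (ii) follows from (E) the EXISTENCE of an equivalence
`Ψ^Base : D₁ ⥤ D₂` with `Base₂ ∘ Ψ ≅ Ψ^Base ∘ Base₁` — the content of the printed passage through `C^birat`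
and `(C^birat)^un-tr` — and (R) the rigidity of `Base₂ ∘ Ψ` for slim `D₁, D₂` (Prop. 1.13 (i)).
[cite: MochizukiFrdI2008, Cor. 4.11 (ii) p.91] -/
theorem cor411ii_of_exists_base_equivalence
    (hbase : ∀ X : D₁, ∃ A : C₁, Nonempty (S₁.base.obj A ≅ X))
    (hconn : ∀ (A B : C₁) (g : S₁.base.obj A ≅ S₁.base.obj B), ∃ (X : C₁) (φ : X ⟶ A) (ψ : X ⟶ B),
      IsIso (S₁.base.map φ) ∧ S₁.base.map φ ≫ g.hom = S₁.base.map ψ)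
    (hpb : ∀ (A : C₁) {Y : D₁} (f : Y ⟶ S₁.base.obj A),
      ∃ (A' : C₁) (φ : A' ⟶ A) (e : S₁.base.obj A' ≅ Y), S₁.base.map φ = e.hom ≫ f)
    (hex : ∃ ΨBase : D₁ ⥤ D₂, ΨBase.IsEquivalence ∧ OneCommutes Ψ.functor S₂.base S₁.base ΨBase)
    (hrig : IsSlim D₁ → IsSlim D₂ → IsRigidFunctor (Ψ.functor ⋙ S₂.base)) : Cor411ii S₁ S₂ Ψ := by
  intro _
  obtain ⟨ΨBase, hEq, hsq⟩ := hex
  haveI := hEq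
  refine ⟨ΨBase, oneUniqueSquare_base_of_oneCommutes S₁ S₂ Ψ hbase hconn hpb ΨBase hsq, fun h₁ h₂ => ?_⟩
  obtain ⟨η⟩ := hsq
  exact ⟨hrig h₁ h₂, isRigidFunctor_congr η (hrig h₁ h₂)⟩

end TwoFrobenioids

end PreFrobenioidData

end Literature.AlgebraicGeometry.Frobenioids
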